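import Summits.QuantumFields.YangMills.Theorems.BalabanUVNodesPortS1LZdetPiecesLocGauge

/-!
# NODE O port PT-A — TRANSPORT OF THE LOCALIZED POWER PIECES ALONG INDEX EMBEDDINGS (generic combinatorics for the integer twin `PowMemberIntTwin` of 27930's `stub_LZdetTwin`,
# line `pta_residueW`): if the piece indices, the cube indices and the matrix indices of one (63) power-series datum EMBED into those of another, supports are carried to images, entries
# agree on the image and vanish off it, and the extra pieces inside the image set vanish, then `locPowPiece` and `powMemberPiece` of the two data AGREE

Cell `ym-nodeO-ideate`, porter seat `ymgap-nodeO-port-PTA-1` (gen 8); `--supports stmt-QuantumFields-27930` (helper, P0-free).  [I] = [Balaban1987RG1], [16] = [Balaban1985UV3].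
WHY.  Print's (1.21) «T^{(j+1)} ↗ Z^d … by the localized representation (1.7)»: the localized power pieces of the Gaussian bracket on the torus (pieces indexed by the torus domains `Y ⊆ X`, matrices on the
non-b₀ fluctuation index) must be read as ONE integer formula (pieces indexed by integer cube sets `Ŷ ⊆ X̂`, matrices on integer bonds) through the cover, off the wrap class.  Both readings are
instances of ✓`locPowPiece`∕✓`powMemberPiece`; this file proves the AGREEMENT abstractly, along injections `eι : ι ↪ ι'` (pieces), `eQ : Q ↪ Q'` (cubes), `eS : S ↪ S'` (matrix indices).
* §1 `prod_map_apply_embed` ∕ `prod_map_apply_eq_zero_off_range` ∕ `trace_prod_map_embed` — ordered products of the transported matrices: entries on the image = entries of the source product,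
  entries off the image vanish (non-empty products), traces agree.
* §2 `foldr_union_map_image`, `isChain_map_embed_iff` — supports: unions and the chaining relation are carried by `eQ`.
* §3 ★★ `locPowPiece_transport` (`m ≥ 1`), ★★ `powMemberPiece_transport` — the pieces of `U` and of `eQ '' U` agree.

HONEST FRAMING.  Finite combinatorics ∕ linear algebra; NOTHING of Bałaban's estimates asserted, ported or discharged; `stub_LZdetTwin` ∕ `stub_P0C` ∕ `stub_G3C` ∕ `stub_FE` OPEN; 27930 OPEN · no claim;
NODE O 0∕1; COUNT 8∕28 · K 1∕4 UNMOVED; finite `𝕋⁴_{L^K}` at fixed ε — NOT continuum ∕ OS ∕ Clay; **the Yang–Mills mass gap is NOT proved by any of this.**  No `sorry`, no `def`, no `instance`, no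
`notation`; standard axioms.
-/

noncomputable section

open scoped BigOperators
open Finset

namespace Summit.QuantumFields.YangMills.Theorems.BalabanUVNodesPortS1

section Transport

/-! ## §1  Ordered products of transported matrices -/

/-- A sum over `S'` of a function vanishing off the range of an injection `eS : S → S'` is the sum over `S` of its pull-back. [folklore] -/
theorem sum_eq_sum_comp_of_zero_off_range {S S' : Type} [Fintype S] [Fintype S'] {β : Type*} [AddCommMonoid β] (eS : S → S') (heS : Function.Injective eS)
    (g : S' → β) (hg : ∀ a', a' ∉ Set.range eS → g a' = 0) : ∑ a', g a' = ∑ a, g (eS a) := by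
  classical
  rw [← Finset.sum_image (f := g) (s := univ) (g := eS) fun a _ b _ h => heS h]
  symm
  refine Finset.sum_subset (subset_univ _) fun a' _ ha' => hg a' fun ⟨a, ha⟩ => ha' (mem_image.2 ⟨a, mem_univ _, ha⟩)

/-- **Entries of transported ordered products ON the image**: if `T′(e i)` agrees with `T i` on `eS × eS` and vanishes off it (first index), then so does every ordered product.
[folklore] [cite: Balaban1987RG1, (1.21) p.264 (bookkeeping)] -/
theorem prod_map_apply_embed {S S' : Type} [Fintype S] [DecidableEq S] [Fintype S'] [DecidableEq S'] {ι ι' : Type} (eι : ι → ι') (eS : S → S') (heS : Function.Injective eS) (T : ι → Matrix S S ℂ) (T' : ι' → Matrix S' S' ℂ)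
    (hE1 : ∀ i a b, T' (eι i) (eS a) (eS b) = T i a b) (hE2 : ∀ i a' b', (a' ∉ Set.range eS ∨ b' ∉ Set.range eS) → T' (eι i) a' b' = 0) :
    ∀ (l : List ι) (a b : S), ((l.map fun i => T' (eι i)).prod) (eS a) (eS b) = ((l.map T).prod) a b
  | [], a, b => by
    simp only [List.map_nil, List.prod_nil]
    by_cases h : a = b
    · subst h; simp
    · rw [Matrix.one_apply_ne h, Matrix.one_apply_ne (heS.ne h)]
  | i :: l, a, b => by
    simp only [List.map_cons, List.prod_cons, Matrix.mul_apply]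
    rw [sum_eq_sum_comp_of_zero_off_range eS heS _ fun c' hc' => by rw [hE2 i _ _ (Or.inr hc'), zero_mul]]
    exact sum_congr rfl fun c _ => by rw [hE1, prod_map_apply_embed eι eS heS T T' hE1 hE2 l c b]

/-- **Entries of NON-EMPTY transported ordered products OFF the image vanish.** [folklore] [cite: Balaban1987RG1, (1.21) p.264 (bookkeeping)] -/
theorem prod_map_apply_eq_zero_off_range {S S' : Type} [Fintype S'] [DecidableEq S'] {ι ι' : Type} (eι : ι → ι') (eS : S → S') (T' : ι' → Matrix S' S' ℂ)
    (hE2 : ∀ i a' b', (a' ∉ Set.range eS ∨ b' ∉ Set.range eS) → T' (eι i) a' b' = 0) :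
    ∀ (l : List ι), l ≠ [] → ∀ a' b' : S', (a' ∉ Set.range eS ∨ b' ∉ Set.range eS) → ((l.map fun i => T' (eι i)).prod) a' b' = 0
  | [], h, _, _, _ => (h rfl).elim
  | i :: l, _, a', b', hab => by
    simp only [List.map_cons, List.prod_cons, Matrix.mul_apply]
    rcases hab with ha | hb
    · exact sum_eq_zero fun c' _ => by rw [hE2 i _ _ (Or.inl ha), zero_mul]
    · by_cases hl : l = []
      · subst hl
        simp only [List.map_nil, List.prod_nil]
        rw [Finset.sum_eq_single b' (fun c' _ hc' => by rw [Matrix.one_apply_ne hc', mul_zero]) (fun h => (h (mem_univ _)).elim),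
          hE2 i _ _ (Or.inr hb), zero_mul]
      · exact sum_eq_zero fun c' _ => by rw [prod_map_apply_eq_zero_off_range eι eS T' hE2 l hl c' b' (Or.inr hb), mul_zero]

/-- **Traces of non-empty transported ordered products agree.** [folklore] [cite: Balaban1987RG1, (1.21) p.264 (bookkeeping)] -/
theorem trace_prod_map_embed {S S' : Type} [Fintype S] [DecidableEq S] [Fintype S'] [DecidableEq S'] {ι ι' : Type} (eι : ι → ι') (eS : S → S') (heS : Function.Injective eS) (T : ι → Matrix S S ℂ) (T' : ι' → Matrix S' S' ℂ)
    (hE1 : ∀ i a b, T' (eι i) (eS a) (eS b) = T i a b) (hE2 : ∀ i a' b', (a' ∉ Set.range eS ∨ b' ∉ Set.range eS) → T' (eι i) a' b' = 0)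
    (l : List ι) (hl : l ≠ []) : Matrix.trace ((l.map fun i => T' (eι i)).prod) = Matrix.trace ((l.map T).prod) := by
  simp only [Matrix.trace, Matrix.diag]
  rw [sum_eq_sum_comp_of_zero_off_range eS heS _ fun a' ha' => prod_map_apply_eq_zero_off_range eι eS T' hE2 l hl a' a' (Or.inl ha')]
  exact sum_congr rfl fun a _ => prod_map_apply_embed eι eS heS T T' hE1 hE2 l a a

/-! ## §2  Supports: unions and chaining are carried by an injection of the cube indices -/

/-- The folded union of the image supports is the image of the folded union. [folklore] -/
theorem foldr_union_map_image {Q Q' : Type} [DecidableEq Q] [DecidableEq Q'] {ι ι' : Type} (eQ : Q → Q') (supp : ι → Finset Q) (eι : ι → ι') (supp' : ι' → Finset Q')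
    (hsupp : ∀ i, supp' (eι i) = (supp i).image eQ) :
    ∀ l : List ι, ((l.map eι).map supp').foldr (· ∪ ·) ∅ = ((l.map supp).foldr (· ∪ ·) ∅).image eQ
  | [] => by simp
  | i :: l => by
    simp only [List.map_cons, List.foldr_cons]
    rw [foldr_union_map_image eQ supp eι supp' hsupp l, hsupp, Finset.image_union]

/-- Chaining (consecutive supports meet) is invariant under an injection of the cube indices. [folklore] -/
theorem isChain_map_embed_iff {Q Q' : Type} [DecidableEq Q'] {ι ι' : Type} (eQ : Q → Q') (heQ : Function.Injective eQ) (supp : ι → Finset Q) (eι : ι → ι') (supp' : ι' → Finset Q')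
    (hsupp : ∀ i, supp' (eι i) = (supp i).image eQ) (l : List ι) :
    List.IsChain (fun i' j' => ¬ Disjoint (supp' i') (supp' j')) (l.map eι) ↔ List.IsChain (fun i j => ¬ Disjoint (supp i) (supp j)) l := by
  rw [List.isChain_map]
  refine List.IsChain.iff fun i j => ?_
  rw [hsupp, hsupp, Finset.disjoint_image heQ]

/-! ## §3  ★★ Transport of `locPowPiece` and `powMemberPiece` -/

/-- ★★ **TRANSPORT OF THE LOCALIZED POWER PIECES** (`m ≥ 1`): along injections `eι`, `eQ`, `eS` with image supports, extra pieces inside `eQ '' U` vanishing, entries agreeing on the image and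
vanishing off it, `locPowPiece supp′ T′ m (eQ '' U) = locPowPiece supp T m U`. [cite: Balaban1987RG1, (1.21) p.264, (1.7) p.261; Balaban1985UV3, (63) p.272] -/
theorem locPowPiece_transport {S S' : Type} [Fintype S] [DecidableEq S] [Fintype S'] [DecidableEq S'] {Q Q' : Type} [DecidableEq Q] [DecidableEq Q']
    {ι ι' : Type} [Fintype ι] [DecidableEq ι] [Fintype ι'] [DecidableEq ι'] (supp : ι → Finset Q) (T : ι → Matrix S S ℂ) (supp' : ι' → Finset Q') (T' : ι' → Matrix S' S' ℂ)
    (eι : ι → ι') (heι : Function.Injective eι) (eQ : Q → Q') (heQ : Function.Injective eQ) (eS : S → S') (heS : Function.Injective eS)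
    (hsupp : ∀ i, supp' (eι i) = (supp i).image eQ) (U : Finset Q)
    (hvan : ∀ i', i' ∉ Set.range eι → supp' i' ⊆ U.image eQ → T' i' = 0)
    (hE1 : ∀ i a b, T' (eι i) (eS a) (eS b) = T i a b) (hE2 : ∀ i a' b', (a' ∉ Set.range eS ∨ b' ∉ Set.range eS) → T' (eι i) a' b' = 0)
    {m : ℕ} (hm : 1 ≤ m) :
    locPowPiece supp' T' m (U.image eQ) = locPowPiece supp T m U := by
  classical
  unfold locPowPiece
  rw [sum_filter, sum_filter]
  -- (1) lists of ι' not in the image of `List.map eι` contribute nothing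
  have hsub : (listsLen (S := ι) m).image (List.map eι) ⊆ listsLen (S := ι') m := by
    intro l' hl'
    obtain ⟨l, hl, rfl⟩ := mem_image.1 hl'
    rw [mem_listsLen_iff] at hl ⊢
    rw [List.length_map, hl]
  rw [← Finset.sum_subset hsub ?_]
  · -- (2) reindex over the lists of ι
    rw [Finset.sum_image fun l _ l₂ _ h => (List.map_injective_iff.2 heι) h]
    refine sum_congr rfl fun l hl => ?_
    have hlen : l.length = m := (mem_listsLen_iff m l).1 hl
    have hne : l ≠ [] := by rintro rfl; simp at hlen; omega
    have hunion : ((l.map eι).map supp').foldr (· ∪ ·) ∅ = U.image eQ ↔ (l.map supp).foldr (· ∪ ·) ∅ = U := by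
      rw [foldr_union_map_image eQ supp eι supp' hsupp l]
      exact ⟨fun h => Finset.image_injective heQ h, fun h => by rw [h]⟩
    have hcond : (List.IsChain (fun i' j' => ¬ Disjoint (supp' i') (supp' j')) (l.map eι) ∧ ((l.map eι).map supp').foldr (· ∪ ·) ∅ = U.image eQ) ↔
        (List.IsChain (fun i j => ¬ Disjoint (supp i) (supp j)) l ∧ (l.map supp).foldr (· ∪ ·) ∅ = U) := by
      rw [isChain_map_embed_iff eQ heQ supp eι supp' hsupp l, hunion]
    by_cases hc : List.IsChain (fun i j => ¬ Disjoint (supp i) (supp j)) l ∧ (l.map supp).foldr (· ∪ ·) ∅ = U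
    · rw [if_pos (hcond.2 hc), if_pos hc, List.map_map]
      exact trace_prod_map_embed eι eS heS T T' hE1 hE2 l hne
    · rw [if_neg (fun h => hc (hcond.1 h)), if_neg hc]
  · -- the vanishing of the non-image lists
    intro l' hl' hnot
    split_ifs with hc
    · obtain ⟨hchain, hU⟩ := hc
      -- some member of l' is not in the range of eι
      have hex : ∃ i' ∈ l', i' ∉ Set.range eι := by
        by_contra hall
        push Not at hall
        apply hnot
        -- l' = map eι l for the list of preimages
        have : ∃ l : List ι, l.map eι = l' := by
          clear hl' hnot hchain hU
          induction l' with
          | nil => exact ⟨[], rfl⟩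
          | cons i' l' ih =>
            obtain ⟨i, hi⟩ := hall i' List.mem_cons_self
            obtain ⟨l, hl⟩ := ih fun j' hj' => hall j' (List.mem_cons_of_mem _ hj')
            exact ⟨i :: l, by rw [List.map_cons, hi, hl]⟩
        obtain ⟨l, rfl⟩ := this
        refine mem_image.2 ⟨l, ?_, rfl⟩
        rw [mem_listsLen_iff] at hl' ⊢
        rwa [List.length_map] at hl'
      obtain ⟨i', hi', hni'⟩ := hex
      have hTi' : T' i' = 0 := hvan i' hni' (hU ▸ subset_foldr_union_of_mem supp' hi')
      have hzero : (l'.map T').prod = 0 := List.prod_eq_zero (List.mem_map.2 ⟨i', hi', hTi'⟩)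
      rw [hzero, Matrix.trace_zero]
    · rfl

/-- ★★ **TRANSPORT OF THE POWER-MEMBER PIECES**: under the hypotheses of `locPowPiece_transport`, `powMemberPiece supp′ T′ R (eQ '' U) = powMemberPiece supp T R U`.
[cite: Balaban1987RG1, (1.21) p.264, (1.7) p.261; Balaban1985UV3, (63) p.272] -/
theorem powMemberPiece_transport {S S' : Type} [Fintype S] [DecidableEq S] [Fintype S'] [DecidableEq S'] {Q Q' : Type} [DecidableEq Q] [DecidableEq Q']
    {ι ι' : Type} [Fintype ι] [DecidableEq ι] [Fintype ι'] [DecidableEq ι'] (supp : ι → Finset Q) (T : ι → Matrix S S ℂ) (supp' : ι' → Finset Q') (T' : ι' → Matrix S' S' ℂ)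
    (eι : ι → ι') (heι : Function.Injective eι) (eQ : Q → Q') (heQ : Function.Injective eQ) (eS : S → S') (heS : Function.Injective eS)
    (hsupp : ∀ i, supp' (eι i) = (supp i).image eQ) (U : Finset Q)
    (hvan : ∀ i', i' ∉ Set.range eι → supp' i' ⊆ U.image eQ → T' i' = 0)
    (hE1 : ∀ i a b, T' (eι i) (eS a) (eS b) = T i a b) (hE2 : ∀ i a' b', (a' ∉ Set.range eS ∨ b' ∉ Set.range eS) → T' (eι i) a' b' = 0) (R : ℝ) :
    powMemberPiece supp' T' R (U.image eQ) = powMemberPiece supp T R U := by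
  unfold powMemberPiece
  exact tsum_congr fun j => by rw [locPowPiece_transport supp T supp' T' eι heι eQ heQ eS heS hsupp U hvan hE1 hE2 (by omega : 1 ≤ j + 1)]

end Transport

end Summit.QuantumFields.YangMills.Theorems.BalabanUVNodesPortS1

end
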